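import Summits.QuantumFields.YangMills.Theorems.BalabanUVNodesK0Stub1BHolds
import Literature.MathematicalPhysics.QuantumFieldTheory.Balaban1983to89.B8Prop6PrintedZdCubPGamma
import Summits.QuantumFields.YangMills.Theorems.BalabanUVNodesK0AllTorusOfStepTokensGuardedZBLamPrintAx
import Summits.QuantumFields.YangMills.Theorems.BalabanUVNodesK0V23Stub3RunwiseSuppliers

/-!
# K0ᴬ (stmt-QuantumFields-27238 `Record13SepCoPHInhabitedAx`) — `…K0V23Stub3RunwiseSuppliers` RE-CENTRED (OP 5a ∕ H3.3, the Ax EDITION): K0ᴬ's body at every family from stub 1ᴮ (PROVED), the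
# stub-2′ text, the displayed Stage-2 seam, and ONE RUN-WISE sign-free bound `|β₁₃ᴬˣ(F; a₀, ε₂₉)_{k+1}(g₀,…,g_k)| ≤ β′` ALONG THE IN-WINDOW SOLUTIONS OF (0.20) per radius, at the re-centred print-regime
# members of `theta13OfThm1CCMWZBAx` (box ⟹ runs, each BY NAME)

Cell `pub-ymgap` (YM-PLAN Track A, D-0062), width seat `pub-ymgap-dag-n07-w3` (g22; dag-lead g40 HANDS-3 H3.3 «Summits side, piecewise after H3.1 lands: the Ax∕χ editions … new basenames,
`--supports stmt-QuantumFields-27238 --as helper`»).  COUNT-NEUTRAL; theorems only — 0 `def` ∕ `sorry` ∕ `instance` ∕ `notation`; NEW additive leaf — dag-n07-w3 g16's `…K0V23Stub3RunwiseSuppliers` (341 l., key 20541 = K0⁷, banked as an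
aside by director-ym №467 (D)) stays landed and true on its own text; nothing in the tree is edited.

WHAT THIS FILE IS.  The σ-IMAGE of `…K0V23Stub3RunwiseSuppliers` under director-ym №467 (D)'s re-centring of K0 (K0⁷ `Record13SepCoPHInhabited` ↦ K0ᴬ `Record13SepCoPHInhabitedAx`, stmt-QuantumFields-27238):
σ = { `theta13OfThm1CCMWZB ↦ theta13OfThm1CCMWZBAx` (def-Y (c) `Node00/Record13NumericsOfThm1CCMWZBChi`, SAME ARITY; letters `X_theta13OfThm1CCMWZBAx` of (c) ∕ (d) `Record13LettersOfThm1CCMWZBChi`),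
`betaOfRecord₁₃ ↦ betaOfRecord₁₃Ax`, `gOfRecord₁₃ ↦ gOfRecord₁₃Ax` ([Ax-3a∕b]), `Provisos₁₃SepCoPH ∕ SlotsNondegenerate₁₃ ↦ …Ax`, `UbgOfRecord₁₃CoP θ ↦ UbgOfRecord₁₃CoPChi θ (chiβOfRecord₁₃Ax θ)`,
`PartCompat₁₃ θ ↦ PartCompat₁₃Chi θ (chiβOfRecord₁₃Ax θ)`, texts `K0V23Defs.AbsBetaBox…GZB{,Eps0}At ↦ K0V23DefsAx.…AxAt` (p803783; stub 1ᴮ `Prop8StepCoPGridGBAt` CENTRE-BLIND, verbatim), door module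
`…GuardedZBLam{,Print} ↦ …GuardedZBLam{,Print}Ax` (this seat, H3.3), crux decl `Record13SepCoPHInhabited ↦ Record13SepCoPHInhabitedAx` }.  Every proof is the source's proof term under σ; theorem
names are the source's (new namespace `…Ax`), except where a name embeds a renamed stem.
HONEST FRAMING OF THE EDITION (binding; the source's framing below carries over verbatim under σ).  Count-neutral kernel bookkeeping; nothing of Bałaban asserted, valued or discharged;
every ★ theorem CONDITIONAL on its displayed hypotheses (NODE O's wall — the run-wise ∕ comparability ∕ box core of β at the re-centred member — is inhabited nowhere); K0ᴬ 27238 ∕ K1ᴬ 27239 ∕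
K3ᴬ 27247 OPEN; N07 ∕ N09 NOT discharged; COUNT 8∕28 · K 1∕4 UNMOVED; R4 = the CONDITIONAL finite-𝕋⁴ rung `BalabanLadder.UV` only — NOT continuum ∕ ℝ⁴ ∕ OS; **the Yang–Mills mass gap (Clay)
is NOT proved by any of this.**

── THE SOURCE's OWN ACCOUNT (σ-applied; «K0⁷» there reads «K0ᴬ» here, «V23 text» reads «re-centred text (V24 candidate, registered by plan g99 — not here)») ──
WHY.  The K0 door (`…GuardedZBLam` §2) needs only the two COMPARABILITY CLAUSES `ε_m ≤ 2ε_{m+1}`, `ε_{m+1} ≤ 2ε_m` along the record's own γ-windowed runs ([III] (2.6)–(2.8)); the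
registered stub 3ᴬ′ᴮ supplies them from a β-BOX on the whole window.  k0-s3-w2's residue `…K0Stub3RunwiseFace` (V19∕V20-keyed, εbg = 1 members, imports `…K0V19Stub2Prime` — red after the
seam) observed that a RUN-WISE two-sided bound of β — β read only «along the runs `0 < g_k ≤ γ`» as [I] Thm 3 p.264 prints it — already gives both clauses (same arithmetic as node O P3's
sign-free box lemma, read at the run prefixes only), and K1⁹'s registered stub 2″ is typed in exactly this run currency (`RunConstRemainder`).  THIS FILE puts the run road on the V23 road at
the print-regime Z3 members: §1 private generic lemmas (in-window generated runs solve (0.20); both clauses along `genSeq` from a run-wise bound); §2 θ-generic and window-generic public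
statements (`hcompBoth_of_runAbsBound` at any `θ` with `θ.γ ≤ ½`; box ⟹ run bound); §3 at `θ₁₃ᶜᶜᴹᵂᶻᴮ(j; γ; εbg; …)`: the run bound of the HALF-WINDOW member at level `γ ≤ ½` transfers
to the `γ`-window member (DEF-1's β transfer read along runs), both clauses there, the window-shrinking (`exists_window_letters_signFree`), ★★ the K0 body at a door from the ᴮ (8)-sentence,
the ᴮ (9)-token, `hDat`, `hseam` and ONE run-wise letter; §4 ★★★ K0ᴬ's BODY ∀F from stub 1ᴮ PROVED + the stub-2′ text + the seam + the RUN-WISE TOKEN-FREE CORE «∀ a₀ > 0, ∃ γ₀ ε₂₉ β′,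
run bound of β₁₃(F; a₀, ε₂₉) at level γ₀» (§4′: 2′ discharged `private`ly, leaving ONLY `hseam` + the run core); §5 the registered box text ∕ the box core ⟹ the run core (so this road
is never harder to feed than stub 3ᴬ′ᴮ; the converse is NOT claimed).

HONEST FRAMING (binding).  Elementary real bookkeeping ((0.20) one-step arithmetic, window shrinking) + by-name composition over LANDED green modules; NO β estimate; the run-wise
bound is a HYPOTHESIS (NODE O's wall read along runs: [I] Thm 3 p.264, §1 p.264 «uniformly bounded» STATED, proof unpublished [II] p.355) inhabited nowhere; `hseam` is the displayed
Stage-2 seam (pre-seam NOT provable, not claimed; post-seam `rw [UbgOfRecord₁₃CoP_succ_chi]`); nothing of Bałaban asserted; this road does NOT close the registered stub 3ᴬ′ᴮ (a box) and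
closes K0ᴬ only the day a producer delivers the run core AND the seam is in the tree; V23 NOT registered; K0ᴬ stmt-QuantumFields-27238 NOT closed; N07 NOT discharged; K1⁹ ∕ K3⁸
OPEN; counts UNMOVED (typed 28∕28 · discharged 8∕28, route display 8∕27 excl. NODE O; K 1∕4); R4 = the CONDITIONAL finite-𝕋⁴ rung `BalabanLadder.UV` at fixed `ε = L^(−K)` only — NOT
continuum ∕ ℝ⁴ ∕ OS; the Yang–Mills mass gap (Clay) is NOT proved by any of this.  Standard axioms only.
-/

noncomputable section

open scoped Matrix.Norms.L2Operator

namespace Summit.QuantumFields.YangMills.Theorems.K0V23Stub3RunwiseSuppliersAx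

open Literature.MathematicalPhysics.QuantumFieldTheory.Balaban1983to89
open Literature.MathematicalPhysics.QuantumFieldTheory.Balaban1983to89.Node00
open Literature.MathematicalPhysics.QuantumFieldTheory.Balaban1983to89.T4Continuum
open Literature.MathematicalPhysics.QuantumFieldTheory.Balaban1983to89.FlowStep
open Literature.MathematicalPhysics.QuantumFieldTheory.Balaban1983to89.FlowStepRuns
open Literature.MathematicalPhysics.QuantumFieldTheory.Balaban1983to89.B15DeterminingSets
open Literature.MathematicalPhysics.QuantumFieldTheory.Balaban1983to89.B8LeafModelZd (ZdIdx)
open Literature.MathematicalPhysics.QuantumFieldTheory.Balaban1983to89.B8Prop6PrintedZdCubPGamma (prop6Printed_zdCubP_γ_holds_pos)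
open Summit.QuantumFields.YangMills.Theorems.K0V23DefsAx (AbsBetaBoxAtThm1WitnessCCMGenGridGZBAxAt)
open Summit.QuantumFields.YangMills.BalabanUVNodes.K0Stub1BHolds (prop8StepCoPGridGBAt_holds)
open Summit.QuantumFields.YangMills.BalabanUVNodes.N07Thm1Top7FromProp8GuardedB (variationalThm1RegSepCoP7MGB_of_prop8TopStepGB_lamDatum)
open Summit.QuantumFields.YangMills.Theorems.K0PrintCubeOfStepTokensGridGuardedB (gauge9SupplierG3B_of_prop6MemberP)
open Summit.QuantumFields.YangMills.Theorems.K0AllTorusOfStepTokensGuardedZBLamAx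
  (exists_k0SepCoPH_thm1CCMWZBAx_gridGuard_of_thm1RegSepCoP7MGB_of_gauge9TopStepGB_lam hDat_dataSmall7LamTopOfAx)
open Summit.QuantumFields.YangMills.Theorems.K0V23Stub3RunwiseSuppliers (runAbsBound_of_absBox runAbsBound_mono nonneg_of_runAbsBound)

/-! ## §1  Private generic lemmas: in-window generated runs solve (0.20); both clauses along `genSeq β g₀` from a run-wise two-sided bound -/

section Generic

/-- An in-window generated run solves (0.20) (k0-s3-w2's raw-sequence form, re-homed `private`). [cite: Balaban1987RG1, (0.18)–(0.20) pp.255–256] -/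
private theorem rgEqH_genSeq_of_inInterval' {β : HBeta} {g0 γ : ℝ} {n : ℕ} (hI : Step.InInterval γ n (genSeq β g0)) :
    RGEqH n β (genSeq β g0) := by
  intro k hk
  have hpos : 0 < genSeq β g0 (k + 1) := (hI (k + 1) (Nat.succ_le_of_lt hk)).1
  have h := inv_sq_genSeq_succ β g0 hpos
  rw [one_div, one_div, h]
  ring

/-- Both comparability clauses along `genSeq β g₀` from the window `γ ≤ ½` and `|β_m(g₀,…,g_m)| ≤ β′` FOR `m < n` ALONG THIS RUN, letter `β′·γ² ≤ ¾` (`p₀ = 1`, `0 ≤ A₀`; node O P3's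
one-step arithmetic read at the run prefixes only). [cite: Balaban1988Convergent, (2.4) p.255, (2.6)–(2.8) pp.255–256; Balaban1987RG1, (0.20) p.256, Thm 3 p.264] -/
private theorem hcompBoth_genSeq_of_runAbs (ν : Stage7Numerics) (hp : ν.p₀ = 1) (hA : 0 ≤ ν.A₀) {β : HBeta} {g0 γ β' : ℝ} {n : ℕ}
    (hI : Step.InInterval γ n (genSeq β g0)) (hγ : γ ≤ 1 / 2)
    (hrun : ∀ m, m < n → |β m (prefixOf (genSeq β g0) m)| ≤ β') (hu : β' * γ ^ 2 ≤ 3 / 4) :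
    (∀ m, m < n → epsOfRecord ν (genSeq β g0) m ≤ 2 * epsOfRecord ν (genSeq β g0) (m + 1)) ∧
    (∀ m, m < n → epsOfRecord ν (genSeq β g0) (m + 1) ≤ 2 * epsOfRecord ν (genSeq β g0) m) := by
  have key : ∀ m, m < n → genSeq β g0 m ≤ 2 * genSeq β g0 (m + 1) ∧ genSeq β g0 (m + 1) ≤ 2 * genSeq β g0 m := by
    intro m hm
    have hgm := hI m hm.le
    have hgm' := hI (m + 1) hm
    have hβlo : -β' ≤ β m (prefixOf (genSeq β g0) m) := (abs_le.mp (hrun m hm)).1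
    have hβup : β m (prefixOf (genSeq β g0) m) ≤ β' := (abs_le.mp (hrun m hm)).2
    have hβ'0 : 0 ≤ β' := (abs_nonneg _).trans (hrun m hm)
    have hid := inv_sq_genSeq_succ β g0 hgm'.1
    have hg2 : genSeq β g0 m ^ 2 ≤ γ ^ 2 := pow_le_pow_left₀ hgm.1.le hgm.2 2
    refine ⟨le_two_mul_of_inv_sq_step_lower (t := β') hgm.1 hgm'.1 (by rw [hid]; linarith) ?_,
      le_two_mul_of_inv_sq_step_upper (t := β') hgm.1 hgm'.1 (by rw [hid]; linarith) ?_⟩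
    · exact ((mul_le_mul_of_nonneg_left hg2 hβ'0).trans hu).trans (by norm_num)
    · exact (mul_le_mul_of_nonneg_left hg2 hβ'0).trans hu
  refine ⟨fun m hm => ?_, fun m hm => ?_⟩
  · have hgm := hI m hm.le
    have hgm' := hI (m + 1) hm
    exact epsOfRecord_le_two_mul_of_le_two_mul ν hp hA hgm.1 hgm'.1 (hgm.2.trans hγ) (hgm'.2.trans hγ) (key m hm).1
  · have hgm := hI m hm.le
    have hgm' := hI (m + 1) hm
    exact epsOfRecord_le_two_mul_of_le_two_mul ν hp hA hgm'.1 hgm.1 (hgm'.2.trans hγ) (hgm.2.trans hγ) (key m hm).2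

end Generic

/-! ## §2  θ-generic ∕ window-generic public statements -/

section Theta

variable {F : T4Family} {N : ℕ} [NeZero N]

/-- **★ (hcomp) ∧ (hcompRev) AT A GENERIC `θ : Stage13Params F N` FROM A RUN-WISE SIGN-FREE BOUND OF ITS OWN β-FUNCTIONS** (`θ.γ ≤ ½`, `p₀ = 1`, `0 ≤ A₀`, `0 ≤ cR`, letter
`β′·θ.γ² ≤ ¾`): `|β₁₃(θ)_{k+1}(g₀,…,g_k)| ≤ β′` at every prefix of every solution of (0.20) up to `n` staying in `]0, θ.γ]` — DEF-1's `RunConstRemainder β₁₃(θ) 0 β′ θ.γ`, displayed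
UNFOLDED — ⟹ for every run `p`, `n ≤ K`, history in the window up to `n`, and `m < n`: `cR·ε_m ≤ 2·(cR·ε_{m+1})` and `cR·ε_{m+1} ≤ 2·(cR·ε_m)`.  Neither the sign of β nor any value of β
OFF the runs is among the hypotheses.  θ-GENERIC; CONDITIONAL. [cite: Balaban1988Convergent, (2.4) p.255, (2.6)–(2.8) pp.255–256; Balaban1987RG1, (0.20) p.256, Thm 3 p.264] -/
theorem hcompBoth_of_runAbsBound (θ : Stage13Params F N) (hA : 0 ≤ θ.ν.A₀) (hp : θ.ν.p₀ = 1) (hγ : θ.γ ≤ 1 / 2) (hcR : 0 ≤ θ.s2.cR) {β' : ℝ}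
    (hR : ∀ (n : ℕ) (gs : ℕ → ℝ), RGEqH n (betaOfRecord₁₃Ax F N θ) gs → Step.InInterval θ.γ n gs → ∀ k, k ≤ n → |betaOfRecord₁₃Ax F N θ k (prefixOf gs k)| ≤ β')
    (hu : β' * θ.γ ^ 2 ≤ 3 / 4) :
    (∀ (p : B12.RunParams) (n : ℕ), n ≤ p.K → Step.InInterval θ.γ n (gOfRecord₁₃Ax F N θ p) → ∀ m, m < n →
      θ.s2.cR * epsOfRecord θ.ν (gOfRecord₁₃Ax F N θ p) m ≤ 2 * (θ.s2.cR * epsOfRecord θ.ν (gOfRecord₁₃Ax F N θ p) (m + 1))) ∧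
    (∀ (p : B12.RunParams) (n : ℕ), n ≤ p.K → Step.InInterval θ.γ n (gOfRecord₁₃Ax F N θ p) → ∀ m, m < n →
      θ.s2.cR * epsOfRecord θ.ν (gOfRecord₁₃Ax F N θ p) (m + 1) ≤ 2 * (θ.s2.cR * epsOfRecord θ.ν (gOfRecord₁₃Ax F N θ p) m)) := by
  have key : ∀ (p : B12.RunParams) (n : ℕ), Step.InInterval θ.γ n (gOfRecord₁₃Ax F N θ p) →
      (∀ m, m < n → epsOfRecord θ.ν (gOfRecord₁₃Ax F N θ p) m ≤ 2 * epsOfRecord θ.ν (gOfRecord₁₃Ax F N θ p) (m + 1)) ∧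
      (∀ m, m < n → epsOfRecord θ.ν (gOfRecord₁₃Ax F N θ p) (m + 1) ≤ 2 * epsOfRecord θ.ν (gOfRecord₁₃Ax F N θ p) m) := fun p n hw =>
    hcompBoth_genSeq_of_runAbs θ.ν hp hA hw hγ
      (fun m hm => hR n _ (rgEqH_genSeq_of_inInterval' hw) hw m hm.le) hu
  exact ⟨fun p n _ hw => hcomp_mul_of_hcomp θ.ν hcR (key p n hw).1, fun p n _ hw => hcompRev_mul_of_hcompRev θ.ν hcR (key p n hw).2⟩

end Theta

/-! ## §3  At the print-regime Z3 members `θ₁₃ᶜᶜᴹᵂᶻᴮ(j; γ; εbg; …)`: transfer along runs, both clauses, and ★★ the K0 body at a door from ONE run-wise letter -/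

section ZB

variable (F : T4Family) {j : ℕ} {γ εbg ε₀ ε₂₉ B₃ B₃' a₀ a₁ : ℝ} {Efl logz : B12.RunParams → ℕ → ℝ}

/-- **A RUN-WISE BOUND OF THE HALF-WINDOW MEMBER AT LEVEL `γ ≤ ½` IS ONE OF THE `γ`-WINDOW MEMBER** `θ₁₃ᶜᶜᴹᵂᶻᴮ(j; γ; εbg; …)`: along a solution of (0.20) staying in `]0, γ]` every
prefix lies in `]0, γ]^{k+1}`, where the two members' β-functions of record COINCIDE (DEF-1's `betaOfRecord₁₃_theta13OfThm1CCMWZBAx_eq_of_mem`), so the run solves (0.20) for BOTH β's and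
the bound transfers verbatim. [cite: Balaban1987RG1, (1.20)–(1.22) p.264, (0.20) p.256, Thm 3 p.264 (bookkeeping)] -/
theorem runAbsBound_theta13OfThm1CCMWZBAx_of_half (hγ : γ ≤ 1 / 2) {β' : ℝ}
    (h : ∀ (n : ℕ) (gs : ℕ → ℝ), RGEqH n (betaOfRecord₁₃Ax F 2 (theta13OfThm1CCMWZBAx F 2 j (1 / 2) εbg ε₀ ε₂₉ B₃ B₃' a₀ a₁ Efl logz)) gs → Step.InInterval γ n gs →
      ∀ k, k ≤ n → |betaOfRecord₁₃Ax F 2 (theta13OfThm1CCMWZBAx F 2 j (1 / 2) εbg ε₀ ε₂₉ B₃ B₃' a₀ a₁ Efl logz) k (prefixOf gs k)| ≤ β') :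
    ∀ (n : ℕ) (gs : ℕ → ℝ), RGEqH n (betaOfRecord₁₃Ax F 2 (theta13OfThm1CCMWZBAx F 2 j γ εbg ε₀ ε₂₉ B₃ B₃' a₀ a₁ Efl logz)) gs → Step.InInterval γ n gs →
      ∀ k, k ≤ n → |betaOfRecord₁₃Ax F 2 (theta13OfThm1CCMWZBAx F 2 j γ εbg ε₀ ε₂₉ B₃ B₃' a₀ a₁ Efl logz) k (prefixOf gs k)| ≤ β' := by
  intro n gs hrg hI k hk
  have hbox : ∀ k', k' ≤ n → prefixOf gs k' ∈ Box γ k' := fun k' hk' =>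
    mem_box.mpr fun i => hI i ((Nat.lt_succ_iff.mp i.isLt).trans hk')
  have hrg' : RGEqH n (betaOfRecord₁₃Ax F 2 (theta13OfThm1CCMWZBAx F 2 j (1 / 2) εbg ε₀ ε₂₉ B₃ B₃' a₀ a₁ Efl logz)) gs := fun k' hk' => by
    rw [← betaOfRecord₁₃_theta13OfThm1CCMWZBAx_eq_of_mem (j := j) (γ := γ) (εbg := εbg) hγ (hbox k' hk'.le)]
    exact hrg k' hk'
  rw [betaOfRecord₁₃_theta13OfThm1CCMWZBAx_eq_of_mem hγ (hbox k hk)]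
  exact h n gs hrg' hI k hk

/-- **★ (hcomp) ∧ (hcompRev) AT `θ₁₃ᶜᶜᴹᵂᶻᴮ(j; γ; εbg; …)` FROM A RUN-WISE BOUND OF THE HALF-WINDOW MEMBER AT LEVEL `γ ≤ ½`** (letter `β′·γ² ≤ ¾`; weak signs of the class constants;
`θ.γ = γ`, `p₀ = 1`, `cR = 1`, `A₀ = A₀ᶜᶜ¹ ≥ 0` by Z3's `rfl` faces).  §3's transfer then §2.  CONDITIONAL on the displayed run bound. [cite: Balaban1988Convergent, (2.4) p.255, (2.6)–(2.8) pp.255–256; Balaban1987RG1, (0.20) p.256, (1.20)–(1.22) p.264, Thm 3 p.264] -/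
theorem hcompBoth_theta13OfThm1CCMWZBAx_of_runAbsBound_half (hγ : γ ≤ 1 / 2) (hB : 0 ≤ B₃) (hB' : 0 ≤ B₃') (ha₀ : 0 ≤ a₀) (ha₁ : 0 ≤ a₁) {β' : ℝ}
    (hR : ∀ (n : ℕ) (gs : ℕ → ℝ), RGEqH n (betaOfRecord₁₃Ax F 2 (theta13OfThm1CCMWZBAx F 2 j (1 / 2) εbg ε₀ ε₂₉ B₃ B₃' a₀ a₁ Efl logz)) gs → Step.InInterval γ n gs →
      ∀ k, k ≤ n → |betaOfRecord₁₃Ax F 2 (theta13OfThm1CCMWZBAx F 2 j (1 / 2) εbg ε₀ ε₂₉ B₃ B₃' a₀ a₁ Efl logz) k (prefixOf gs k)| ≤ β')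
    (hu : β' * γ ^ 2 ≤ 3 / 4) :
    (∀ (p : B12.RunParams) (n : ℕ), n ≤ p.K → Step.InInterval (theta13OfThm1CCMWZBAx F 2 j γ εbg ε₀ ε₂₉ B₃ B₃' a₀ a₁ Efl logz).γ n (gOfRecord₁₃Ax F 2 (theta13OfThm1CCMWZBAx F 2 j γ εbg ε₀ ε₂₉ B₃ B₃' a₀ a₁ Efl logz) p) → ∀ m, m < n →
      (theta13OfThm1CCMWZBAx F 2 j γ εbg ε₀ ε₂₉ B₃ B₃' a₀ a₁ Efl logz).s2.cR * epsOfRecord (theta13OfThm1CCMWZBAx F 2 j γ εbg ε₀ ε₂₉ B₃ B₃' a₀ a₁ Efl logz).ν (gOfRecord₁₃Ax F 2 (theta13OfThm1CCMWZBAx F 2 j γ εbg ε₀ ε₂₉ B₃ B₃' a₀ a₁ Efl logz) p) m ≤ 2 * ((theta13OfThm1CCMWZBAx F 2 j γ εbg ε₀ ε₂₉ B₃ B₃' a₀ a₁ Efl logz).s2.cR * epsOfRecord (theta13OfThm1CCMWZBAx F 2 j γ εbg ε₀ ε₂₉ B₃ B₃' a₀ a₁ Efl logz).ν (gOfRecord₁₃Ax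 F 2 (theta13OfThm1CCMWZBAx F 2 j γ εbg ε₀ ε₂₉ B₃ B₃' a₀ a₁ Efl logz) p) (m + 1))) ∧
    (∀ (p : B12.RunParams) (n : ℕ), n ≤ p.K → Step.InInterval (theta13OfThm1CCMWZBAx F 2 j γ εbg ε₀ ε₂₉ B₃ B₃' a₀ a₁ Efl logz).γ n (gOfRecord₁₃Ax F 2 (theta13OfThm1CCMWZBAx F 2 j γ εbg ε₀ ε₂₉ B₃ B₃' a₀ a₁ Efl logz) p) → ∀ m, m < n →
      (theta13OfThm1CCMWZBAx F 2 j γ εbg ε₀ ε₂₉ B₃ B₃' a₀ a₁ Efl logz).s2.cR * epsOfRecord (theta13OfThm1CCMWZBAx F 2 j γ εbg ε₀ ε₂₉ B₃ B₃' a₀ a₁ Efl logz).ν (gOfRecord₁₃Ax F 2 (theta13OfThm1CCMWZBAx F 2 j γ εbg ε₀ ε₂₉ B₃ B₃' a₀ a₁ Efl logz) p) (m + 1) ≤ 2 * ((theta13OfThm1CCMWZBAx F 2 j γ εbg ε₀ ε₂₉ B₃ B₃' a₀ a₁ Efl logz).s2.cR * epsOfRecord (theta13OfThm1CCMWZBAx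 F 2 j γ εbg ε₀ ε₂₉ B₃ B₃' a₀ a₁ Efl logz).ν (gOfRecord₁₃Ax F 2 (theta13OfThm1CCMWZBAx F 2 j γ εbg ε₀ ε₂₉ B₃ B₃' a₀ a₁ Efl logz) p) m)) := by
  have hγ' := theta13OfThm1CCMWZBAx_γ F 2 j γ εbg ε₀ ε₂₉ B₃ B₃' a₀ a₁ Efl logz
  have hR' := runAbsBound_theta13OfThm1CCMWZBAx_of_half F hγ hR
  have h := hcompBoth_of_runAbsBound (theta13OfThm1CCMWZBAx F 2 j γ εbg ε₀ ε₂₉ B₃ B₃' a₀ a₁ Efl logz)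
    (by rw [theta13OfThm1CCMWZBAx_A₀]; exact A0OfThm1CC1_nonneg hB hB' ha₀ ha₁) (theta13OfThm1CCMWZBAx_p₀ F 2 j γ εbg ε₀ ε₂₉ B₃ B₃' a₀ a₁ Efl logz) (by rw [hγ']; exact hγ)
    (by rw [theta13OfThm1CCMWZBAx_cR]; norm_num) (β' := β') (by rw [hγ']; exact hR') (by rw [hγ']; exact hu)
  exact h

/-- **CLAUSES FROM ONE RUN-WISE LETTER OF THE HALF-WINDOW MEMBER**: `∃ γ₀ > 0, β′` with the run bound at level `γ₀` ⟹ SOME window `γ ∈ ]0, ½]` (shrunk so that `β′·γ² ≤ ¾`,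
`exists_window_letters_signFree`; `0 ≤ β′` is forced) on which the `γ`-window member satisfies both clauses.  CONDITIONAL. [cite: Balaban1987RG1, Thm 1 p.259, Thm 3 p.264, §1 p.264; Balaban1988Convergent, (2.6)–(2.8) pp.255–256] -/
theorem exists_window_clausesZB_of_runAbsBound_half (hB : 0 ≤ B₃) (hB' : 0 ≤ B₃') (ha₀ : 0 ≤ a₀) (ha₁ : 0 ≤ a₁)
    (h : ∃ γ₀ β' : ℝ, 0 < γ₀ ∧
      ∀ (n : ℕ) (gs : ℕ → ℝ), RGEqH n (betaOfRecord₁₃Ax F 2 (theta13OfThm1CCMWZBAx F 2 j (1 / 2) εbg ε₀ ε₂₉ B₃ B₃' a₀ a₁ Efl logz)) gs → Step.InInterval γ₀ n gs →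
        ∀ k, k ≤ n → |betaOfRecord₁₃Ax F 2 (theta13OfThm1CCMWZBAx F 2 j (1 / 2) εbg ε₀ ε₂₉ B₃ B₃' a₀ a₁ Efl logz) k (prefixOf gs k)| ≤ β') :
    ∃ γ : ℝ, 0 < γ ∧ γ ≤ 1 / 2 ∧
    (∀ (p : B12.RunParams) (n : ℕ), n ≤ p.K → Step.InInterval (theta13OfThm1CCMWZBAx F 2 j γ εbg ε₀ ε₂₉ B₃ B₃' a₀ a₁ Efl logz).γ n (gOfRecord₁₃Ax F 2 (theta13OfThm1CCMWZBAx F 2 j γ εbg ε₀ ε₂₉ B₃ B₃' a₀ a₁ Efl logz) p) → ∀ m, m < n →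
      (theta13OfThm1CCMWZBAx F 2 j γ εbg ε₀ ε₂₉ B₃ B₃' a₀ a₁ Efl logz).s2.cR * epsOfRecord (theta13OfThm1CCMWZBAx F 2 j γ εbg ε₀ ε₂₉ B₃ B₃' a₀ a₁ Efl logz).ν (gOfRecord₁₃Ax F 2 (theta13OfThm1CCMWZBAx F 2 j γ εbg ε₀ ε₂₉ B₃ B₃' a₀ a₁ Efl logz) p) m ≤ 2 * ((theta13OfThm1CCMWZBAx F 2 j γ εbg ε₀ ε₂₉ B₃ B₃' a₀ a₁ Efl logz).s2.cR * epsOfRecord (theta13OfThm1CCMWZBAx F 2 j γ εbg ε₀ ε₂₉ B₃ B₃' a₀ a₁ Efl logz).ν (gOfRecord₁₃Ax F 2 (theta13OfThm1CCMWZBAx F 2 j γ εbg ε₀ ε₂₉ B₃ B₃' a₀ a₁ Efl logz) p) (m + 1))) ∧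
    (∀ (p : B12.RunParams) (n : ℕ), n ≤ p.K → Step.InInterval (theta13OfThm1CCMWZBAx F 2 j γ εbg ε₀ ε₂₉ B₃ B₃' a₀ a₁ Efl logz).γ n (gOfRecord₁₃Ax F 2 (theta13OfThm1CCMWZBAx F 2 j γ εbg ε₀ ε₂₉ B₃ B₃' a₀ a₁ Efl logz) p) → ∀ m, m < n →
      (theta13OfThm1CCMWZBAx F 2 j γ εbg ε₀ ε₂₉ B₃ B₃' a₀ a₁ Efl logz).s2.cR * epsOfRecord (theta13OfThm1CCMWZBAx F 2 j γ εbg ε₀ ε₂₉ B₃ B₃' a₀ a₁ Efl logz).ν (gOfRecord₁₃Ax F 2 (theta13OfThm1CCMWZBAx F 2 j γ εbg ε₀ ε₂₉ B₃ B₃' a₀ a₁ Efl logz) p) (m + 1) ≤ 2 * ((theta13OfThm1CCMWZBAx F 2 j γ εbg ε₀ ε₂₉ B₃ B₃' a₀ a₁ Efl logz).s2.cR * epsOfRecord (theta13OfThm1CCMWZBAx F 2 j γ εbg ε₀ ε₂₉ B₃ B₃' a₀ a₁ Efl logz).ν (gOfRecord₁₃Ax F 2 (theta13OfThm1CCMWZBAx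 F 2 j γ εbg ε₀ ε₂₉ B₃ B₃' a₀ a₁ Efl logz) p) m)) := by
  obtain ⟨γ₀, β', hγ0, hR⟩ := h
  have hβ' : 0 ≤ β' := nonneg_of_runAbsBound hγ0 hR
  obtain ⟨γ, hγpos, hγle, hγhalf, -, hu⟩ := exists_window_letters_signFree hγ0 hβ'
  exact ⟨γ, hγpos, hγhalf, hcompBoth_theta13OfThm1CCMWZBAx_of_runAbsBound_half F hγhalf hB hB' ha₀ ha₁ (runAbsBound_mono hγle hR) hu⟩

/-- **★★ THE ⁷ K0 BODY FOR `F` AT AN ARBITRARY CUBE LETTER `(L^j, c, c₀, c₁)` FROM THE ᴮ (8)-SENTENCE, THE ᴮ (9)-TOKEN UNDER `A‴`, `hDat`, THE SEAM, AND ONE RUN-WISE LETTER OF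
`β₁₃(θ₁₃ᶜᶜᴹᵂᶻᴮ(j; ½; εbg; …))`** — k0-s1-w1's door `exists_k0SepCoPH_thm1CCMWZBAx_gridGuard_of_thm1RegSepCoP7MGB_of_gauge9TopStepGB_lam` at the shrunk window of the previous theorem.
The run-wise twin of `…ZBLam.exists_k0H_of_thm1CoP7MGB_of_gauge9GB_of_absBoxZBAx_lam` (whose box hypothesis is STRONGER, §2 `runAbsBound_of_absBox`).  CONDITIONAL on every displayed letter;
nothing of Bałaban asserted. [cite: Balaban1985Variational, Thm 1 (8)–(9) p.279, (144)–(152) pp.300–301, Prop. 8 p.304; Balaban1984PropagatorsII, (2.3) p.224; Balaban1988Convergent, Thm 1 p.262, (2.1) p.254, (2.5)–(2.8) pp.255–256, (2.12)–(2.13) pp.256–257, (2.21) p.258; Balaban1987RG1, Thm 1 p.259, Thm 3 p.264, (0.1) p.251, (1.12) p.262] -/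
theorem exists_k0H_of_thm1CoP7MGB_of_gauge9GB_of_runAbsBoxZB_lam {Dat : TopData F 2} {c c₀ c₁ : ℕ} (hc : c ≤ F.L ^ j) (hc₀ : c₀ ≤ j + 1) (hc₁ : c₁ ≤ j)
    (hbg : 0 < εbg) (hB₃ : 0 ≤ B₃) (hB' : 0 ≤ B₃') (ha₀ : 0 < a₀) (ha₁ : 0 < a₁)
    (h15 : VariationalThm1RegSepCoP7MGB F 2 (fun ν M g K k _s => c ≤ ν.M₁ ∧ k + c₀ ≤ F.m + K ∧ F.L ^ c₁ ∣ M ∧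
      ∀ i, 1 ≤ i → i ≤ k → dCubeSide (F.P K).L M (RkOfRecord (F.P K).L ν.r (g i)) i ∣ (F.P K).sitesPerDir 0) (lamDatum F) Dat B₃ a₀ a₁)
    (h9 : Gauge9RegSepTopStepGB F 2 (fun ν K Ω => suppDomOfRecord F ν K Ω) (F.L ^ j) (fun ν M g K k _s => c ≤ ν.M₁ ∧ k + c₀ ≤ F.m + K ∧ F.L ^ c₁ ∣ M ∧
      ∀ i, 1 ≤ i → i ≤ k → dCubeSide (F.P K).L M (RkOfRecord (F.P K).L ν.r (g i)) i ∣ (F.P K).sitesPerDir 0) (lamDatum F) Dat B₃ B₃' a₀ a₁)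
    (hDat : ∀ (θ : Stage13Params F 2) (p : B12.RunParams) (n : ℕ) (s : SeqOfRecord F θ.ν θ.τ9.M (gOfRecord₁₃Ax F 2 θ p) p.K n) (δ : ℕ → ℝ) (W : MSField (F.P p.K) (SU 2)),
      n ≤ p.K → PartCompat₁₃Chi F 2 θ (chiβOfRecord₁₃Ax F 2 θ) p n →
      Sect2.DataSmall7PTop (avOfRecord F 2 p.K) s.Ω (suppDomOfRecord F θ.ν p.K s.Ω) n δ W → Dat p.K s.Ω (suppDomOfRecord F θ.ν p.K s.Ω) n δ W)
    (hseam : ∀ (θ : Stage13Params F 2) (p : B12.RunParams) (n : ℕ) (s : SeqOfRecord F θ.ν θ.τ9.M (gOfRecord₁₃Ax F 2 θ p) p.K (n + 1)) (W : MSField (F.P p.K) (SU 2)),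
      UbgOfRecord₁₃CoPChi F 2 θ (chiβOfRecord₁₃Ax F 2 θ) p (n + 1) s W = UbgMSCoPOfRecordB F 2 θ.ν θ.τ9.M (gOfRecord₁₃Ax F 2 θ p) p.K (n + 1) s W)
    (h3R : ∃ γ₀ ε₀ ε₂₉ β' : ℝ, 0 < γ₀ ∧ 0 < ε₀ ∧ 0 < ε₂₉ ∧
      ∀ (n : ℕ) (gs : ℕ → ℝ), RGEqH n (betaOfRecord₁₃Ax F 2 (theta13OfThm1CCMWZBAx F 2 j (1 / 2) εbg ε₀ ε₂₉ B₃ B₃' a₀ a₁ Efl logz)) gs → Step.InInterval γ₀ n gs →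
        ∀ k, k ≤ n → |betaOfRecord₁₃Ax F 2 (theta13OfThm1CCMWZBAx F 2 j (1 / 2) εbg ε₀ ε₂₉ B₃ B₃' a₀ a₁ Efl logz) k (prefixOf gs k)| ≤ β') :
    ∃ θ : Stage13HParams F 2, θ.Provisos₁₃SepCoPHAx F 2 ∧ (θ.ZhUnity F 2 ∧ θ.SlotsNondegenerate₁₃Ax F 2) ∧ θ.Admissible F 2 := by
  obtain ⟨γ₀, ε₀, ε₂₉, β', hγ0, hε, hε', hR⟩ := h3R
  obtain ⟨γ, hγpos, hγhalf, hcomp, hcompRev⟩ :=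
    exists_window_clausesZB_of_runAbsBound_half F (εbg := εbg) (ε₀ := ε₀) (ε₂₉ := ε₂₉) (Efl := Efl) (logz := logz) hB₃ hB' ha₀.le ha₁.le ⟨γ₀, β', hγ0, hR⟩
  exact exists_k0SepCoPH_thm1CCMWZBAx_gridGuard_of_thm1RegSepCoP7MGB_of_gauge9TopStepGB_lam F hγpos hγhalf hbg hε hε' hB₃ hB' ha₀ ha₁ hc hc₀ hc₁ h15 h9 hDat hseam hcomp hcompRev

end ZB

/-! ## §4  ★★★ K0ᴬ's BODY AT EVERY FAMILY from stub 1ᴮ (PROVED), the stub-2′ text, the seam and the RUN-WISE TOKEN-FREE CORE -/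

section ByName

/-- [6] Prop. 6 as printed on print's class (the door's `h2P` binder; the skeleton's F4 five-liner, `private` — no public supplier by design). [cite: Balaban1985RegularSpaces, Prop. 6 (1.135)–(1.138) p.99, (1.3)–(1.6) p.77] -/
private theorem twoPrime (F : T4Family) :
    ∃ (ρ₀ : ℕ) (B₁ c₁ : ℝ), 1 ≤ ρ₀ ∧ 0 ≤ B₁ ∧ 0 < c₁ ∧
      (letI : CStarAlgebra (MatA 2) := {}; B8.Prop6Printed 4 (F.L : ℝ) B₁ c₁ (fun i : ZdIdx 4 F.L => zdCubP (MatA 2) F.L ρ₀ i)) := by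
  letI : CStarAlgebra (MatA 2) := {}
  have hL5 : 5 ≤ F.L := by have := F.hL11; omega
  obtain ⟨ρ₀, B₁, c₁, hρ₀, hB₁, hc₁, H⟩ :=
    prop6Printed_zdCubP_γ_holds_pos (𝔸 := MatA 2) (d := 4) (by norm_num) hL5 F.hL.1
  exact ⟨ρ₀, B₁, c₁, hρ₀, hB₁.le, hc₁, H (fun i : ZdIdx 4 F.L => i)⟩

/-- Letter census (`rfl`, = ✓p769914 `K0V23Stub3SocketsAx.betaOfRecord₁₃_zbRegime_letterBlind`, `private` to stay route-independent). [cite: Balaban1987RG1, (1.20)–(1.22) p.264, (2.9) p.266 (bookkeeping)] -/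
private theorem census (F : T4Family) (j j' : ℕ) (a₀ ε₀ ε₀' ε₂₉ B₃ C₃ B₃' C₃' a₁ c₁ : ℝ) (Efl logz Efl' logz' : B12.RunParams → ℕ → ℝ) :
    betaOfRecord₁₃Ax F 2 (theta13OfThm1CCMWZBAx F 2 j (1 / 2) a₀ ε₀ ε₂₉ B₃ B₃' a₀ a₁ Efl logz) =
      betaOfRecord₁₃Ax F 2 (theta13OfThm1CCMWZBAx F 2 j' (1 / 2) a₀ ε₀' ε₂₉ C₃ C₃' a₀ c₁ Efl' logz') := rfl

/-- **★★★ K0ᴬ's BODY AT EVERY FAMILY FROM stub 1ᴮ PROVED (`K0Stub1BHolds`), THE STUB-2′ TEXT `h2P`, THE DISPLAYED SEAM `hseam`, AND THE RUN-WISE TOKEN-FREE CORE** «for every radius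
`a₀ > 0` SOME `γ₀, ε₂₉ > 0`, `β′` with `|β₁₃(F; a₀, ε₂₉)_{k+1}(g₀,…,g_k)| ≤ β′` along every solution of (0.20) staying in `]0, γ₀]`» (β read at the print-regime Z3 member; any letters, by
the census).  Composition = k0-s1-w1's `…ZBLam` §4 with the box replaced by the run letter: stub 1ᴮ's ∃-letters, [15] Prop. 8's top step at their radius, dag-n07-w2's (9)-supplier, 53′,
`hDat_dataSmall7LamTopOfAx`, §3.  A WEAKER sufficient condition for K0ᴬ than the registered stub 3ᴬ′ᴮ (§5).  CONDITIONAL on `hseam`, `h2P` and the run core; K0ᴬ NOT closed;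
nothing of Bałaban asserted. [cite: Balaban1985Variational, Thm 1 (8)–(9) p.279, (7) p.278, Prop. 8 p.304; Balaban1985RegularSpaces, Prop. 6 p.99; Balaban1984PropagatorsII, (2.3) p.224; Balaban1988Convergent, Thm 1 p.262, (2.1) p.254, (2.6)–(2.8) pp.255–256, (2.12)–(2.13) pp.256–257, (2.18) p.257; Balaban1987RG1, Thm 1 p.259, Thm 3 p.264, §1 p.264, (0.1) p.251; Balaban1989LargeFieldII, p.355] -/
theorem k0Body_of_runwiseZB_byName
    (hseam : ∀ (F : T4Family) (θ : Stage13Params F 2) (p : B12.RunParams) (n : ℕ) (s : SeqOfRecord F θ.ν θ.τ9.M (gOfRecord₁₃Ax F 2 θ p) p.K (n + 1)) (W : MSField (F.P p.K) (SU 2)),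
      UbgOfRecord₁₃CoPChi F 2 θ (chiβOfRecord₁₃Ax F 2 θ) p (n + 1) s W = UbgMSCoPOfRecordB F 2 θ.ν θ.τ9.M (gOfRecord₁₃Ax F 2 θ p) p.K (n + 1) s W)
    (h2P : ∀ F : T4Family, ∃ (ρ₀ : ℕ) (B₁ c₁ : ℝ), 1 ≤ ρ₀ ∧ 0 ≤ B₁ ∧ 0 < c₁ ∧
      (letI : CStarAlgebra (MatA 2) := {}; B8.Prop6Printed 4 (F.L : ℝ) B₁ c₁ (fun i : ZdIdx 4 F.L => zdCubP (MatA 2) F.L ρ₀ i)))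
    (run : ∀ (F : T4Family) (a₀ : ℝ), 0 < a₀ → ∃ γ₀ ε₂₉ β' : ℝ, 0 < γ₀ ∧ 0 < ε₂₉ ∧ ∀ (j : ℕ) (ε₀ B₃ B₃' a₁ : ℝ),
      ∀ (n : ℕ) (gs : ℕ → ℝ), RGEqH n (betaOfRecord₁₃Ax F 2 (theta13OfThm1CCMWZBAx F 2 j (1 / 2) a₀ ε₀ ε₂₉ B₃ B₃' a₀ a₁ (fun _ _ => 0) (fun _ _ => 0))) gs → Step.InInterval γ₀ n gs →
        ∀ k, k ≤ n → |betaOfRecord₁₃Ax F 2 (theta13OfThm1CCMWZBAx F 2 j (1 / 2) a₀ ε₀ ε₂₉ B₃ B₃' a₀ a₁ (fun _ _ => 0) (fun _ _ => 0)) k (prefixOf gs k)| ≤ β') :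
    ∀ F : T4Family, ∃ θ : Stage13HParams F 2, θ.Provisos₁₃SepCoPHAx F 2 ∧ (θ.ZhUnity F 2 ∧ θ.SlotsNondegenerate₁₃Ax F 2) ∧ θ.Admissible F 2 := by
  intro F
  obtain ⟨c, c₀, c₁, B₃, a₀, a₁, hB₃, ha₀, ha₁, h8⟩ := prop8StepCoPGridGBAt_holds F
  have hL : (0 : ℝ) < (F.L : ℝ) := by exact_mod_cast lt_trans Nat.zero_lt_one F.hL.2
  have hBpos : (0 : ℝ) < B₃ := lt_of_lt_of_le (mul_pos two_pos (pow_pos hL 2)) hB₃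
  obtain ⟨j, c', B₉, a₁', hcc', hc', hc₀, hc₁, hB₉, ha₁', ha₁'le, h9⟩ :=
    gauge9SupplierG3B_of_prop6MemberP F (h2P F) (lamDatum F) (dataSmall7LamTopOf F 2) c c₀ c₁ B₃ a₀ a₁ hB₃ ha₀ ha₁ h8
  have h15 : VariationalThm1RegSepCoP7MGB F 2 (fun ν M g K k _s => c' ≤ ν.M₁ ∧ k + c₀ ≤ F.m + K ∧ F.L ^ c₁ ∣ M ∧
      ∀ i, 1 ≤ i → i ≤ k → dCubeSide (F.P K).L M (RkOfRecord (F.P K).L ν.r (g i)) i ∣ (F.P K).sitesPerDir 0) (lamDatum F) (dataSmall7LamTopOf F 2) B₃ a₀ a₁' :=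
    (variationalThm1RegSepCoP7MGB_of_prop8TopStepGB_lamDatum hBpos (h8.of_le le_rfl ha₁'le)).of_imp fun _ _ _ _ _ _ h => ⟨hcc'.trans h.1, h.2⟩
  obtain ⟨γ₀, ε₂₉, β', hγ₀, hε', hall⟩ := run F a₀ ha₀
  exact exists_k0H_of_thm1CoP7MGB_of_gauge9GB_of_runAbsBoxZB_lam F (εbg := a₀) (Efl := fun _ _ => 0) (logz := fun _ _ => 0) hc' hc₀ hc₁ ha₀ hBpos.le hB₉.le ha₀ ha₁' h15 h9
    (fun θ p n s δ W hn hpc h7 => hDat_dataSmall7LamTopOfAx F 2 θ p n s δ W hn hpc h7) (hseam F)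
    ⟨γ₀, a₀, ε₂₉, β', hγ₀, ha₀, hε', hall j a₀ B₃ B₉ a₁'⟩

/-- **§4′ ★★★ THE SAME WITH THE STUB-2′ TEXT DISCHARGED** from the green Literature theorem `B8Prop6PrintedZdCubPGamma.prop6Printed_zdCubP_γ_holds_pos` ([6] Prop. 6 as printed; the
skeleton's F4 five-liner, `private` here) — so K0ᴬ's body at every family follows from the displayed SEAM and the RUN-WISE TOKEN-FREE CORE ALONE.  CONDITIONAL on both; K0ᴬ NOT
closed. [cite: Balaban1985RegularSpaces, Prop. 6 p.99; Balaban1988Convergent, Thm 1 p.262, (2.12)–(2.13) pp.256–257; Balaban1987RG1, Thm 3 p.264, §1 p.264; Balaban1989LargeFieldII, p.355] -/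
theorem k0Body_of_seam_of_runwiseZB
    (hseam : ∀ (F : T4Family) (θ : Stage13Params F 2) (p : B12.RunParams) (n : ℕ) (s : SeqOfRecord F θ.ν θ.τ9.M (gOfRecord₁₃Ax F 2 θ p) p.K (n + 1)) (W : MSField (F.P p.K) (SU 2)),
      UbgOfRecord₁₃CoPChi F 2 θ (chiβOfRecord₁₃Ax F 2 θ) p (n + 1) s W = UbgMSCoPOfRecordB F 2 θ.ν θ.τ9.M (gOfRecord₁₃Ax F 2 θ p) p.K (n + 1) s W)
    (run : ∀ (F : T4Family) (a₀ : ℝ), 0 < a₀ → ∃ γ₀ ε₂₉ β' : ℝ, 0 < γ₀ ∧ 0 < ε₂₉ ∧ ∀ (j : ℕ) (ε₀ B₃ B₃' a₁ : ℝ),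
      ∀ (n : ℕ) (gs : ℕ → ℝ), RGEqH n (betaOfRecord₁₃Ax F 2 (theta13OfThm1CCMWZBAx F 2 j (1 / 2) a₀ ε₀ ε₂₉ B₃ B₃' a₀ a₁ (fun _ _ => 0) (fun _ _ => 0))) gs → Step.InInterval γ₀ n gs →
        ∀ k, k ≤ n → |betaOfRecord₁₃Ax F 2 (theta13OfThm1CCMWZBAx F 2 j (1 / 2) a₀ ε₀ ε₂₉ B₃ B₃' a₀ a₁ (fun _ _ => 0) (fun _ _ => 0)) k (prefixOf gs k)| ≤ β') :
    ∀ F : T4Family, ∃ θ : Stage13HParams F 2, θ.Provisos₁₃SepCoPHAx F 2 ∧ (θ.ZhUnity F 2 ∧ θ.SlotsNondegenerate₁₃Ax F 2) ∧ θ.Admissible F 2 :=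
  k0Body_of_runwiseZB_byName hseam twoPrime run

/-- **A run bound at ANY ONE member per radius is the run-wise core** (census): a producer may deliver at whatever letters its road carries. [cite: Balaban1987RG1, Thm 3 p.264, (1.20)–(1.22) p.264, (2.9) p.266 (bookkeeping)] -/
theorem runwiseZB_of_runAtOneMember (F : T4Family)
    (h : ∀ a₀ : ℝ, 0 < a₀ → ∃ (γ₀ ε₂₉ β' : ℝ) (j : ℕ) (ε₀ B₃ B₃' a₁ : ℝ) (Efl logz : B12.RunParams → ℕ → ℝ), 0 < γ₀ ∧ 0 < ε₂₉ ∧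
      ∀ (n : ℕ) (gs : ℕ → ℝ), RGEqH n (betaOfRecord₁₃Ax F 2 (theta13OfThm1CCMWZBAx F 2 j (1 / 2) a₀ ε₀ ε₂₉ B₃ B₃' a₀ a₁ Efl logz)) gs → Step.InInterval γ₀ n gs →
        ∀ k, k ≤ n → |betaOfRecord₁₃Ax F 2 (theta13OfThm1CCMWZBAx F 2 j (1 / 2) a₀ ε₀ ε₂₉ B₃ B₃' a₀ a₁ Efl logz) k (prefixOf gs k)| ≤ β') :
    ∀ a₀ : ℝ, 0 < a₀ → ∃ γ₀ ε₂₉ β' : ℝ, 0 < γ₀ ∧ 0 < ε₂₉ ∧ ∀ (j : ℕ) (ε₀ B₃ B₃' a₁ : ℝ),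
      ∀ (n : ℕ) (gs : ℕ → ℝ), RGEqH n (betaOfRecord₁₃Ax F 2 (theta13OfThm1CCMWZBAx F 2 j (1 / 2) a₀ ε₀ ε₂₉ B₃ B₃' a₀ a₁ (fun _ _ => 0) (fun _ _ => 0))) gs → Step.InInterval γ₀ n gs →
        ∀ k, k ≤ n → |betaOfRecord₁₃Ax F 2 (theta13OfThm1CCMWZBAx F 2 j (1 / 2) a₀ ε₀ ε₂₉ B₃ B₃' a₀ a₁ (fun _ _ => 0) (fun _ _ => 0)) k (prefixOf gs k)| ≤ β' := by
  intro a₀ ha₀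
  obtain ⟨γ₀, ε₂₉, β', j, ε₀, B₃, B₃', a₁, Efl, logz, hγ₀, hε', hR⟩ := h a₀ ha₀
  refine ⟨γ₀, ε₂₉, β', hγ₀, hε', fun j' ε₀' C₃ C₃' c₁' => ?_⟩
  rw [← census F j j' a₀ ε₀ ε₀' ε₂₉ B₃ C₃ B₃' C₃' a₁ c₁' Efl logz (fun _ _ => 0) (fun _ _ => 0)]
  exact hR

end ByName

/-! ## §5  The registered V23 stub-3ᴬ′ᴮ text ∕ the box core ⟹ the run-wise core (this road is never harder to feed; the converse is NOT claimed) -/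

section FromBox

variable (F : T4Family)

/-- **THE BOX CORE ⟹ THE RUN-WISE CORE** (§2 `runAbsBound_of_absBox`, member by member). [cite: Balaban1987RG1, §1 (1.22) p.264, Thm 3 p.264 (bookkeeping)] -/
theorem runwiseZB_of_tokenFreeZB
    (box : ∀ a₀ : ℝ, 0 < a₀ → ∃ γ₀ ε₂₉ β' : ℝ, 0 < γ₀ ∧ 0 < ε₂₉ ∧ ∀ (j : ℕ) (ε₀ B₃ B₃' a₁ : ℝ),
      BetaLowerH (-β') γ₀ (betaOfRecord₁₃Ax F 2 (theta13OfThm1CCMWZBAx F 2 j (1 / 2) a₀ ε₀ ε₂₉ B₃ B₃' a₀ a₁ (fun _ _ => 0) (fun _ _ => 0))) ∧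
      BetaUpperH β' γ₀ (betaOfRecord₁₃Ax F 2 (theta13OfThm1CCMWZBAx F 2 j (1 / 2) a₀ ε₀ ε₂₉ B₃ B₃' a₀ a₁ (fun _ _ => 0) (fun _ _ => 0)))) :
    ∀ a₀ : ℝ, 0 < a₀ → ∃ γ₀ ε₂₉ β' : ℝ, 0 < γ₀ ∧ 0 < ε₂₉ ∧ ∀ (j : ℕ) (ε₀ B₃ B₃' a₁ : ℝ),
      ∀ (n : ℕ) (gs : ℕ → ℝ), RGEqH n (betaOfRecord₁₃Ax F 2 (theta13OfThm1CCMWZBAx F 2 j (1 / 2) a₀ ε₀ ε₂₉ B₃ B₃' a₀ a₁ (fun _ _ => 0) (fun _ _ => 0))) gs → Step.InInterval γ₀ n gs →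
        ∀ k, k ≤ n → |betaOfRecord₁₃Ax F 2 (theta13OfThm1CCMWZBAx F 2 j (1 / 2) a₀ ε₀ ε₂₉ B₃ B₃' a₀ a₁ (fun _ _ => 0) (fun _ _ => 0)) k (prefixOf gs k)| ≤ β' := by
  intro a₀ ha₀
  obtain ⟨γ₀, ε₂₉, β', hγ₀, hε', hall⟩ := box a₀ ha₀
  exact ⟨γ₀, ε₂₉, β', hγ₀, hε', fun j ε₀ B₃ B₃' a₁ => runAbsBound_of_absBox (hall j ε₀ B₃ B₃' a₁).1 (hall j ε₀ B₃ B₃' a₁).2⟩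

/-- **A DOOR's BOX ⟹ THE DOOR's RUN LETTER**: the ∃-conclusion of the V23 stub-3ᴬ′ᴮ text at a door (a box of `θ₁₃ᶜᶜᴹᵂᶻᴮ(j; ½; εbg; ε₀, ε₂₉; …)` for SOME `γ₀, ε₀, ε₂₉, β′`) gives
§3's run-wise letter `h3R` at the same door.  (The text ⟹ the run-wise CORE on `(0, ā]` is ✓p770586 `K0V23Stub3NonVacuity.tokenFreeZB_below_of_absBetaBoxGZBAt` followed by
`runwiseZB_of_tokenFreeZB`.) [cite: Balaban1987RG1, Thm 1 p.259, §1 (1.22) p.264, Thm 3 p.264 (bookkeeping)] -/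
theorem runAbsBoxZB_of_absBoxZB {j : ℕ} {εbg B₃ B₃' a₀ a₁ : ℝ} {Efl logz : B12.RunParams → ℕ → ℝ}
    (h : ∃ γ₀ ε₀ ε₂₉ β' : ℝ, 0 < γ₀ ∧ 0 < ε₀ ∧ 0 < ε₂₉ ∧
      BetaLowerH (-β') γ₀ (betaOfRecord₁₃Ax F 2 (theta13OfThm1CCMWZBAx F 2 j (1 / 2) εbg ε₀ ε₂₉ B₃ B₃' a₀ a₁ Efl logz)) ∧
      BetaUpperH β' γ₀ (betaOfRecord₁₃Ax F 2 (theta13OfThm1CCMWZBAx F 2 j (1 / 2) εbg ε₀ ε₂₉ B₃ B₃' a₀ a₁ Efl logz))) :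
    ∃ γ₀ ε₀ ε₂₉ β' : ℝ, 0 < γ₀ ∧ 0 < ε₀ ∧ 0 < ε₂₉ ∧
      ∀ (n : ℕ) (gs : ℕ → ℝ), RGEqH n (betaOfRecord₁₃Ax F 2 (theta13OfThm1CCMWZBAx F 2 j (1 / 2) εbg ε₀ ε₂₉ B₃ B₃' a₀ a₁ Efl logz)) gs → Step.InInterval γ₀ n gs →
        ∀ k, k ≤ n → |betaOfRecord₁₃Ax F 2 (theta13OfThm1CCMWZBAx F 2 j (1 / 2) εbg ε₀ ε₂₉ B₃ B₃' a₀ a₁ Efl logz) k (prefixOf gs k)| ≤ β' := by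
  obtain ⟨γ₀, ε₀, ε₂₉, β', hγ₀, hε, hε', hlow, hup⟩ := h
  exact ⟨γ₀, ε₀, ε₂₉, β', hγ₀, hε, hε', runAbsBound_of_absBox hlow hup⟩

end FromBox

end Summit.QuantumFields.YangMills.Theorems.K0V23Stub3RunwiseSuppliersAx

end
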